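import Summits.RiemannHypothesis.RiemannHypothesis.Theorems.SignConeConeMagnificationCombTypeFamilies
import Literature.Analysis.Asymptotics.StepRatioRiemannSum

/-!
# Crux `SignCone.ConeMagnification` (stmt-RiemannHypothesis-16303), line `Sketch` r9, stub `stub_combType` — sharp node evaluation II:
# inside a family, the tooth is the family weight `B(c_m/k')/k'` up to `O(h)`

Backstop, part 2 (continues `…CombTypeFamilies`).  At the node `n` of the pair `(ℓ, ℓ')`, for a tooth `k'` (`u = nℓ'k'/ℓ`,
`a = nℓ'k' = ℓu`, `g = gcd(nℓ', ℓ)`) and the family `m` (abscissa `x_m = (a + g m)/ℓ = u(1 + y)`, `y = g m/a`):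

* `T(m) = B((log u − log x_m)/h)/√(x_m k' n)` (the reorganised tooth term of `CombType.family_reorg`) and
  `W(m) = B(c_m/k')/k' · (√ℓ/√ℓ')/n`, `c_m = −g m/(nℓ'h)` (the family weight of
  `Literature.NumberTheory.LFunctions.abs_familySum_sub_integral_le`) BOTH VANISH unless `|g m| ≤ 8h·a`
  (`CombType.familyT_eq_zero`, `CombType.familyW_eq_zero`);
* for `|g m| ≤ 8h·a` (`0 < h ≤ 1/16`): `|T(m) − W(m)| ≤ (182N₁ + 12N₀)·h/(√u √k' √n)` (`CombType.abs_familyT_sub_familyW_le`: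
  `|log(1+y) − y| ≤ 2y²`, `|B(p) − B(q)| ≤ N₁|p − q|`, `|1/√x_m − 1/√u| ≤ √2|y|/√u`);
* hence over any finite set of families `|Σ_m (T(m) − W(m))| ≤ (16h·a/g + 1)(182N₁ + 12N₀)·h/(√u √k' √n)`
  (`CombType.abs_sum_familyT_sub_familyW_le`).
-/

noncomputable section

-- `Summit.RiemannHypothesis.RiemannHypothesis.…` repeats a namespace component by design (D-0017 layout).
set_option linter.dupNamespace false

open scoped BigOperators
open MeasureTheory Set

namespace Summit.RiemannHypothesis.RiemannHypothesis.Theorems.SignConeConeMagnification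

open Literature.NumberTheory.LFunctions

namespace CombType

/-- Lipschitz bound for the bump: `|B p − B q| ≤ N₁ |p − q|`. [folklore] -/
theorem abs_bump_sub_le {B B' : ℝ → ℝ} {N₁ : ℝ} (hB : ∀ x, HasDerivAt B (B' x) x) (h1 : ∀ x, |B' x| ≤ N₁) (p q : ℝ) :
    |B p - B q| ≤ N₁ * |p - q| := by
  have := convex_univ.norm_image_sub_le_of_norm_hasDerivWithin_le (f := B) (f' := B') (C := N₁)
    (fun x _ => (hB x).hasDerivWithinAt) (fun x _ => by simpa [Real.norm_eq_abs] using h1 x) (mem_univ q) (mem_univ p)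
  simpa [Real.norm_eq_abs] using this

/-- `|1/√x − 1/√u| ≤ √2·|x − u|/(u√u)` for `u > 0`, `x ≥ u/2`. [folklore] -/
theorem abs_inv_sqrt_sub_inv_sqrt_le {u x : ℝ} (hu : 0 < u) (hx : u / 2 ≤ x) :
    |1 / Real.sqrt x - 1 / Real.sqrt u| ≤ Real.sqrt 2 * |x - u| / (u * Real.sqrt u) := by
  have hx0 : 0 < x := by linarith
  have hsu : 0 < Real.sqrt u := Real.sqrt_pos.2 hu
  have hsx : 0 < Real.sqrt x := Real.sqrt_pos.2 hx0
  have hs2 : 0 < Real.sqrt 2 := Real.sqrt_pos.2 (by norm_num)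
  -- `√u ≤ √2 √x`
  have hux : Real.sqrt u ≤ Real.sqrt 2 * Real.sqrt x := by
    rw [← Real.sqrt_mul (by norm_num : (0:ℝ) ≤ 2)]
    exact Real.sqrt_le_sqrt (by linarith)
  have e : 1 / Real.sqrt x - 1 / Real.sqrt u = (Real.sqrt u - Real.sqrt x) / (Real.sqrt x * Real.sqrt u) := by
    field_simp
  rw [e, abs_div, abs_of_pos (mul_pos hsx hsu)]
  -- `|√u − √x| = |u − x|/(√u + √x)`
  have hdiff : |Real.sqrt u - Real.sqrt x| * (Real.sqrt u + Real.sqrt x) = |u - x| := by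
    have h1 : (Real.sqrt u - Real.sqrt x) * (Real.sqrt u + Real.sqrt x) = u - x := by
      have := Real.mul_self_sqrt hu.le
      have := Real.mul_self_sqrt hx0.le
      nlinarith
    rw [← abs_of_pos (add_pos hsu hsx), ← abs_mul, h1]
  rw [div_le_div_iff₀ (mul_pos hsx hsu) (mul_pos hu hsu)]
  rw [abs_sub_comm x u]
  -- goal: |√u − √x| * (u √u) ≤ √2 |u − x| * (√x √u)
  have hden : 0 < Real.sqrt u + Real.sqrt x := add_pos hsu hsx
  have key : |Real.sqrt u - Real.sqrt x| = |u - x| / (Real.sqrt u + Real.sqrt x) := by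
    rw [eq_div_iff hden.ne', hdiff]
  rw [key, div_mul_eq_mul_div, div_le_iff₀ hden]
  have habs : 0 ≤ |u - x| := abs_nonneg _
  -- `u √u ≤ √2 √x √u (√u + √x)`, since `u = √u √u ≤ √2 √x √u`
  have h3 : u * Real.sqrt u ≤ Real.sqrt 2 * (Real.sqrt x * Real.sqrt u) * (Real.sqrt u + Real.sqrt x) := by
    have hu' : u = Real.sqrt u * Real.sqrt u := (Real.mul_self_sqrt hu.le).symm
    calc u * Real.sqrt u = Real.sqrt u * Real.sqrt u * Real.sqrt u := by rw [← hu']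
      _ ≤ (Real.sqrt 2 * Real.sqrt x) * Real.sqrt u * Real.sqrt u := by
          apply mul_le_mul_of_nonneg_right (mul_le_mul_of_nonneg_right hux hsu.le) hsu.le
      _ ≤ (Real.sqrt 2 * Real.sqrt x) * Real.sqrt u * (Real.sqrt u + Real.sqrt x) := by
          apply mul_le_mul_of_nonneg_left (by linarith) (by positivity)
      _ = Real.sqrt 2 * (Real.sqrt x * Real.sqrt u) * (Real.sqrt u + Real.sqrt x) := by ring
  calc |u - x| * (u * Real.sqrt u) ≤ |u - x| * (Real.sqrt 2 * (Real.sqrt x * Real.sqrt u) * (Real.sqrt u + Real.sqrt x)) :=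
        mul_le_mul_of_nonneg_left h3 habs
    _ = Real.sqrt 2 * |u - x| * (Real.sqrt x * Real.sqrt u) * (Real.sqrt u + Real.sqrt x) := by ring

/-- **The reorganised tooth term vanishes off `|g m| ≤ 8h a`.**  With `u = nℓ'k'/ℓ`, `x = (nℓ'k' + g m)/ℓ`:
if `8h·nℓ'k' < |g m|` then `B((log u − log x)/h)/√x/√k'/√n = 0` (`0 < h ≤ 1/8`). [folklore] -/
theorem familyT_eq_zero {B : ℝ → ℝ} (hBs : ∀ x, 2 < |x| → B x = 0) {h : ℝ} (hh : 0 < h) (hh8 : h ≤ 1 / 8)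
    {n ℓ ℓ' k' : ℕ} (hn : 1 ≤ n) (hℓ : 1 ≤ ℓ) (hℓ' : 1 ≤ ℓ') (hk' : 1 ≤ k') {g : ℝ} {m : ℤ}
    (hm : 8 * h * ((n : ℝ) * ℓ' * k') < |g * m|) :
    B ((Real.log ((n : ℝ) * ℓ' * k' / ℓ) - Real.log (((n : ℝ) * ℓ' * k' + g * m) / ℓ)) / h)
      / Real.sqrt (((n : ℝ) * ℓ' * k' + g * m) / ℓ) / Real.sqrt k' / Real.sqrt n = 0 := by
  have hℓ0 : (0 : ℝ) < ℓ := by exact_mod_cast hℓ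
  have hn0 : (0 : ℝ) < n := by exact_mod_cast hn
  have hℓ'0 : (0 : ℝ) < ℓ' := by exact_mod_cast hℓ'
  have hk'0 : (0 : ℝ) < k' := by exact_mod_cast hk'
  have ha0 : (0 : ℝ) < (n : ℝ) * ℓ' * k' / ℓ := by positivity
  by_cases hx : ((n : ℝ) * ℓ' * k' + g * m) / ℓ ≤ 0
  · rw [Real.sqrt_eq_zero'.2 hx, div_zero, zero_div, zero_div]
  push Not at hx
  by_contra hne
  have hB : B ((Real.log ((n : ℝ) * ℓ' * k' / ℓ) - Real.log (((n : ℝ) * ℓ' * k' + g * m) / ℓ)) / h) ≠ 0 := by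
    intro h0; apply hne; rw [h0, zero_div, zero_div, zero_div]
  obtain ⟨hsup, -⟩ := tooth_support hBs hh hh8 ha0 hx hℓ0 hB
  have e1 : (ℓ : ℝ) * (((n : ℝ) * ℓ' * k' + g * m) / ℓ) - ℓ * ((n : ℝ) * ℓ' * k' / ℓ) = g * m := by field_simp; ring
  have e2 : (ℓ : ℝ) * ((n : ℝ) * ℓ' * k' / ℓ) = (n : ℝ) * ℓ' * k' := by field_simp
  rw [e1, e2] at hsup
  linarith

/-- **The family weight vanishes off `|g m| ≤ 2h a`.**  [folklore] -/
theorem familyW_eq_zero {B : ℝ → ℝ} (hBs : ∀ x, 2 < |x| → B x = 0) {h : ℝ} (hh : 0 < h)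
    {n ℓ' k' : ℕ} (hn : 1 ≤ n) (hℓ' : 1 ≤ ℓ') (hk' : 1 ≤ k') {g : ℝ} {m : ℤ}
    (hm : 2 * h * ((n : ℝ) * ℓ' * k') < |g * m|) :
    B (-(g * m) / ((n : ℝ) * ℓ' * h) / k') = 0 := by
  have hn0 : (0 : ℝ) < n := by exact_mod_cast hn
  have hℓ'0 : (0 : ℝ) < ℓ' := by exact_mod_cast hℓ'
  have hk'0 : (0 : ℝ) < k' := by exact_mod_cast hk'
  apply hBs
  have hpos : 0 < (n : ℝ) * ℓ' * h * k' := by positivity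
  rw [div_div, abs_div, abs_neg, abs_of_pos hpos, lt_div_iff₀ hpos]
  linarith

/-- The two bump values inside a family differ by `O(h)`: `|B(−log(1+y)/h) − B(−y/h)| ≤ 128N₁h` for `|y| ≤ 8h ≤ 1/2`. [folklore] -/
theorem abs_bump_log_sub_bump_lin_le {B B' : ℝ → ℝ} {N₁ : ℝ} (hB : ∀ x, HasDerivAt B (B' x) x) (h1 : ∀ x, |B' x| ≤ N₁)
    {h y : ℝ} (hh : 0 < h) (hh16 : h ≤ 1 / 16) (hy8 : |y| ≤ 8 * h) :
    |B (-Real.log (1 + y) / h) - B (-y / h)| ≤ 128 * N₁ * h := by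
  have hN₁ : 0 ≤ N₁ := (abs_nonneg _).trans (h1 0)
  have hy2 : |y| ≤ 1 / 2 := hy8.trans (by linarith)
  refine (abs_bump_sub_le hB h1 _ _).trans ?_
  have e : -Real.log (1 + y) / h - -y / h = -(Real.log (1 + y) - y) / h := by ring
  rw [e, abs_div, abs_neg, abs_of_pos hh]
  have hl := Literature.Analysis.Asymptotics.abs_log_one_add_sub_le hy2
  have hysq : y ^ 2 ≤ (8 * h) ^ 2 := by
    rw [← sq_abs y]; exact pow_le_pow_left₀ (abs_nonneg y) hy8 2
  calc N₁ * (|Real.log (1 + y) - y| / h) ≤ N₁ * (2 * (8 * h) ^ 2 / h) := by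
        refine mul_le_mul_of_nonneg_left (div_le_div_of_nonneg_right (hl.trans (by linarith)) hh.le) hN₁
    _ = 128 * N₁ * h := by field_simp; ring

/-- The two weights inside a family differ by `O(h)`: for `x = u(1+y)`, `u > 0`, `|y| ≤ 8h ≤ 1/2`:
`|1/√x − 1/√u| ≤ 12h/√u` and `√u ≤ √2·√x`. [folklore] -/
theorem abs_inv_sqrt_family_le {u y h : ℝ} (hu : 0 < u) (hh16 : h ≤ 1 / 16) (hy8 : |y| ≤ 8 * h) :
    |1 / Real.sqrt (u * (1 + y)) - 1 / Real.sqrt u| ≤ 12 * h / Real.sqrt u ∧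
      Real.sqrt u ≤ Real.sqrt 2 * Real.sqrt (u * (1 + y)) := by
  have hy2 : |y| ≤ 1 / 2 := hy8.trans (by linarith)
  have h1y : 1 / 2 ≤ 1 + y := by have := (abs_le.1 hy2).1; linarith
  have hxu2 : u / 2 ≤ u * (1 + y) := by
    have := mul_le_mul_of_nonneg_left h1y hu.le; linarith
  have hsu : 0 < Real.sqrt u := Real.sqrt_pos.2 hu
  have hs2 : Real.sqrt 2 ≤ 3 / 2 := by
    rw [Real.sqrt_le_left (by norm_num)]; norm_num
  constructor
  · have hinv := abs_inv_sqrt_sub_inv_sqrt_le hu hxu2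
    have hxmu : |u * (1 + y) - u| = u * |y| := by
      rw [show u * (1 + y) - u = u * y by ring, abs_mul, abs_of_pos hu]
    rw [hxmu] at hinv
    refine hinv.trans ?_
    rw [div_le_div_iff₀ (by positivity) hsu]
    have hu2 : u * Real.sqrt u = Real.sqrt u * u := mul_comm _ _
    -- `√2 (u|y|) √u ≤ 12 h (u √u)`
    have step1 : Real.sqrt 2 * (u * |y|) ≤ 3 / 2 * (u * (8 * h)) :=
      mul_le_mul hs2 (mul_le_mul_of_nonneg_left hy8 hu.le) (by positivity) (by norm_num)
    calc Real.sqrt 2 * (u * |y|) * Real.sqrt u ≤ 3 / 2 * (u * (8 * h)) * Real.sqrt u :=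
          mul_le_mul_of_nonneg_right step1 hsu.le
      _ = 12 * h * (u * Real.sqrt u) := by ring
  · rw [← Real.sqrt_mul (by norm_num : (0:ℝ) ≤ 2)]
    exact Real.sqrt_le_sqrt (by linarith)

/-- The bookkeeping of `abs_familyT_sub_familyW_le`. [folklore] -/
theorem family_term_algebra {BT BW sx su sk sn E₁ E₂ N₀ : ℝ} (hsx : 0 < sx) (hsu : 0 < su) (hsk : 0 < sk) (hsn : 0 < sn)
    (hB : |BT - BW| ≤ E₁) (hBW : |BW| ≤ N₀) (hinv : |1 / sx - 1 / su| ≤ E₂ / su) (hux : su ≤ 3 / 2 * sx)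
    (hE₁ : 0 ≤ E₁) :
    |BT / sx / sk / sn - BW * (1 / (su * sk * sn))| ≤ (3 / 2 * E₁ + N₀ * E₂) / (su * sk * sn) := by
  have hN₀ : 0 ≤ N₀ := (abs_nonneg _).trans hBW
  have hden : 0 < su * sk * sn := by positivity
  have hsplit : BT / sx / sk / sn - BW * (1 / (su * sk * sn))
      = (BT - BW) / (sx * sk * sn) + BW * (1 / sx - 1 / su) / (sk * sn) := by
    field_simp; ring
  rw [hsplit]
  have hp1 : |(BT - BW) / (sx * sk * sn)| ≤ 3 / 2 * E₁ / (su * sk * sn) := by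
    have hdx : 0 < sx * sk * sn := by positivity
    rw [abs_div, abs_of_pos hdx, div_le_div_iff₀ hdx hden]
    calc |BT - BW| * (su * sk * sn) ≤ E₁ * (3 / 2 * sx * sk * sn) := by
          refine mul_le_mul hB ?_ hden.le hE₁
          have := mul_le_mul_of_nonneg_right (mul_le_mul_of_nonneg_right hux hsk.le) hsn.le
          linarith
      _ = 3 / 2 * E₁ * (sx * sk * sn) := by ring
  have hp2 : |BW * (1 / sx - 1 / su) / (sk * sn)| ≤ N₀ * E₂ / (su * sk * sn) := by
    have hdk : 0 < sk * sn := by positivity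
    rw [abs_div, abs_of_pos hdk, abs_mul, div_le_div_iff₀ hdk hden]
    calc |BW| * |1 / sx - 1 / su| * (su * sk * sn) ≤ N₀ * (E₂ / su) * (su * sk * sn) :=
          mul_le_mul_of_nonneg_right (mul_le_mul hBW hinv (abs_nonneg _) hN₀) hden.le
      _ = N₀ * E₂ * (sk * sn) := by field_simp
  calc |(BT - BW) / (sx * sk * sn) + BW * (1 / sx - 1 / su) / (sk * sn)|
      ≤ |(BT - BW) / (sx * sk * sn)| + |BW * (1 / sx - 1 / su) / (sk * sn)| := abs_add_le _ _
    _ ≤ 3 / 2 * E₁ / (su * sk * sn) + N₀ * E₂ / (su * sk * sn) := add_le_add hp1 hp2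
    _ = (3 / 2 * E₁ + N₀ * E₂) / (su * sk * sn) := by ring

/-- **Inside a family the tooth is the family weight up to `O(h)`.**  For `|g m| ≤ 8h·nℓ'k'` (`0 < h ≤ 1/16`),
`|T(m) − W(m)| ≤ (192N₁ + 12N₀)·h/(√u √k' √n)`, `u = nℓ'k'/ℓ`. [folklore] -/
theorem abs_familyT_sub_familyW_le {B B' : ℝ → ℝ} {N₀ N₁ : ℝ} (hB : ∀ x, HasDerivAt B (B' x) x)
    (h0 : ∀ x, |B x| ≤ N₀) (h1 : ∀ x, |B' x| ≤ N₁) {h : ℝ} (hh : 0 < h) (hh16 : h ≤ 1 / 16)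
    {n ℓ ℓ' k' : ℕ} (hn : 1 ≤ n) (hℓ : 1 ≤ ℓ) (hℓ' : 1 ≤ ℓ') (hk' : 1 ≤ k') {g : ℝ} {m : ℤ}
    (hm : |g * m| ≤ 8 * h * ((n : ℝ) * ℓ' * k')) :
    |B ((Real.log ((n : ℝ) * ℓ' * k' / ℓ) - Real.log (((n : ℝ) * ℓ' * k' + g * m) / ℓ)) / h)
        / Real.sqrt (((n : ℝ) * ℓ' * k' + g * m) / ℓ) / Real.sqrt k' / Real.sqrt n
      - B (-(g * m) / ((n : ℝ) * ℓ' * h) / k') / k' * (Real.sqrt ℓ / Real.sqrt ℓ') / n|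
      ≤ (192 * N₁ + 12 * N₀) * h / (Real.sqrt ((n : ℝ) * ℓ' * k' / ℓ) * Real.sqrt k' * Real.sqrt n) := by
  have hN₁ : 0 ≤ N₁ := (abs_nonneg _).trans (h1 0)
  have hℓ0 : (0 : ℝ) < ℓ := by exact_mod_cast hℓ
  have hn0 : (0 : ℝ) < n := by exact_mod_cast hn
  have hℓ'0 : (0 : ℝ) < ℓ' := by exact_mod_cast hℓ'
  have hk'0 : (0 : ℝ) < k' := by exact_mod_cast hk'
  have ha0 : 0 < (n : ℝ) * ℓ' * k' := by positivity
  have hu0 : 0 < (n : ℝ) * ℓ' * k' / ℓ := by positivity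
  set y : ℝ := g * m / ((n : ℝ) * ℓ' * k') with hy
  have hy8 : |y| ≤ 8 * h := by
    rw [hy, abs_div, abs_of_pos ha0, div_le_iff₀ ha0]; exact hm
  have hy2 : |y| ≤ 1 / 2 := hy8.trans (by linarith)
  have h1y : 0 < 1 + y := by have := (abs_le.1 hy2).1; linarith
  -- the abscissa and the two arguments
  have hxu : ((n : ℝ) * ℓ' * k' + g * m) / ℓ = ((n : ℝ) * ℓ' * k' / ℓ) * (1 + y) := by
    rw [hy]; field_simp
  have hlog : Real.log ((n : ℝ) * ℓ' * k' / ℓ) - Real.log (((n : ℝ) * ℓ' * k' + g * m) / ℓ) = -Real.log (1 + y) := by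
    rw [hxu, Real.log_mul hu0.ne' h1y.ne']; ring
  have hcW : -(g * m) / ((n : ℝ) * ℓ' * h) / k' = -y / h := by
    rw [hy]; field_simp
  have hsn := sqrt_node_mul (n := n) (ℓ' := ℓ') (k' := k') hℓ
  have hwt : B (-(g * m) / ((n : ℝ) * ℓ' * h) / k') / k' * (Real.sqrt ℓ / Real.sqrt ℓ') / n
      = B (-y / h) * (1 / (Real.sqrt ((n : ℝ) * ℓ' * k' / ℓ) * Real.sqrt k' * Real.sqrt n)) := by
    rw [hcW, hsn]
    have hsℓ : 0 < Real.sqrt (ℓ : ℝ) := Real.sqrt_pos.2 hℓ0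
    have hsℓ' : 0 < Real.sqrt (ℓ' : ℝ) := Real.sqrt_pos.2 hℓ'0
    field_simp
  rw [hlog, hwt, hxu]
  obtain ⟨hinv, hux⟩ := abs_inv_sqrt_family_le hu0 hh16 hy8
  have hBd := abs_bump_log_sub_bump_lin_le hB h1 hh hh16 hy8
  have hsx : 0 < Real.sqrt ((n : ℝ) * ℓ' * k' / ℓ * (1 + y)) := Real.sqrt_pos.2 (by positivity)
  have hux' : Real.sqrt ((n : ℝ) * ℓ' * k' / ℓ) ≤ 3 / 2 * Real.sqrt ((n : ℝ) * ℓ' * k' / ℓ * (1 + y)) := by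
    refine hux.trans (mul_le_mul_of_nonneg_right ?_ hsx.le)
    rw [Real.sqrt_le_left (by norm_num)]; norm_num
  have key := family_term_algebra hsx (Real.sqrt_pos.2 hu0) (Real.sqrt_pos.2 hk'0) (Real.sqrt_pos.2 hn0)
    hBd (h0 _) hinv hux' (by positivity)
  refine key.trans (le_of_eq ?_)
  ring

/-- **Summed over the families of one tooth.**  For any finite set `S` of family indices,
`|Σ_{m ∈ S} (T(m) − W(m))| ≤ (16h·nℓ'k'/g + 1)·(192N₁ + 12N₀)·h/(√u √k' √n)`: off `|g m| ≤ 8h·nℓ'k'` both terms vanish, and there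
are at most `16h·nℓ'k'/g + 1` families inside. [folklore] -/
theorem abs_sum_familyT_sub_familyW_le {B B' : ℝ → ℝ} {N₀ N₁ : ℝ} (hB : ∀ x, HasDerivAt B (B' x) x)
    (h0 : ∀ x, |B x| ≤ N₀) (h1 : ∀ x, |B' x| ≤ N₁) (hBs : ∀ x, 2 < |x| → B x = 0)
    {h : ℝ} (hh : 0 < h) (hh16 : h ≤ 1 / 16)
    {n ℓ ℓ' k' : ℕ} (hn : 1 ≤ n) (hℓ : 1 ≤ ℓ) (hℓ' : 1 ≤ ℓ') (hk' : 1 ≤ k') {g : ℝ} (hg : 0 < g) (S : Finset ℤ) :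
    |∑ m ∈ S, (B ((Real.log ((n : ℝ) * ℓ' * k' / ℓ) - Real.log (((n : ℝ) * ℓ' * k' + g * m) / ℓ)) / h)
        / Real.sqrt (((n : ℝ) * ℓ' * k' + g * m) / ℓ) / Real.sqrt k' / Real.sqrt n
      - B (-(g * m) / ((n : ℝ) * ℓ' * h) / k') / k' * (Real.sqrt ℓ / Real.sqrt ℓ') / n)|
      ≤ (16 * h * ((n : ℝ) * ℓ' * k') / g + 1) *
          ((192 * N₁ + 12 * N₀) * h / (Real.sqrt ((n : ℝ) * ℓ' * k' / ℓ) * Real.sqrt k' * Real.sqrt n)) := by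
  classical
  have hN₀ : 0 ≤ N₀ := (abs_nonneg _).trans (h0 0)
  have hN₁ : 0 ≤ N₁ := (abs_nonneg _).trans (h1 0)
  have hn0 : (0 : ℝ) < n := by exact_mod_cast hn
  have hℓ'0 : (0 : ℝ) < ℓ' := by exact_mod_cast hℓ'
  have hk'0 : (0 : ℝ) < k' := by exact_mod_cast hk'
  have ha0 : 0 < (n : ℝ) * ℓ' * k' := by positivity
  have hh8 : h ≤ 1 / 8 := by linarith
  set a : ℝ := (n : ℝ) * ℓ' * k' with ha
  set bnd : ℝ := (192 * N₁ + 12 * N₀) * h / (Real.sqrt ((n : ℝ) * ℓ' * k' / ℓ) * Real.sqrt k' * Real.sqrt n) with hbnd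
  have hbnd0 : 0 ≤ bnd := by rw [hbnd]; positivity
  set F : ℤ → ℝ := fun m => B ((Real.log ((n : ℝ) * ℓ' * k' / ℓ) - Real.log (((n : ℝ) * ℓ' * k' + g * m) / ℓ)) / h)
        / Real.sqrt (((n : ℝ) * ℓ' * k' + g * m) / ℓ) / Real.sqrt k' / Real.sqrt n
      - B (-(g * m) / ((n : ℝ) * ℓ' * h) / k') / k' * (Real.sqrt ℓ / Real.sqrt ℓ') / n with hF
  show |∑ m ∈ S, F m| ≤ (16 * h * a / g + 1) * bnd
  -- off the window both terms vanish
  have hzero : ∀ m ∈ S, ¬ (|g * m| ≤ 8 * h * a) → F m = 0 := by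
    intro m _ hm
    push Not at hm
    have hT := familyT_eq_zero (ℓ := ℓ) hBs hh hh8 hn hℓ hℓ' hk' (g := g) (m := m) hm
    have h2a : 2 * h * ((n : ℝ) * ℓ' * k') ≤ 8 * h * a := by rw [← ha]; nlinarith [mul_pos hh ha0]
    have hW := familyW_eq_zero hBs hh hn hℓ' hk' (g := g) (m := m) (lt_of_le_of_lt h2a hm)
    simp only [hF, hT, hW, zero_div, zero_mul, sub_zero]
  rw [← Finset.sum_filter_of_ne fun m hm hne => by_contra fun hc => hne (hzero m hm hc)]
  -- inside the window: pointwise bound and a count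
  have hpt : ∀ m ∈ S.filter (fun m : ℤ => |g * m| ≤ 8 * h * a), |F m| ≤ bnd := fun m hm =>
    abs_familyT_sub_familyW_le hB h0 h1 hh hh16 hn hℓ hℓ' hk' (Finset.mem_filter.1 hm).2
  have hsub : S.filter (fun m : ℤ => |g * m| ≤ 8 * h * a) ⊆ Finset.Icc (-(⌊8 * h * a / g⌋₊ : ℤ)) ⌊8 * h * a / g⌋₊ := by
    intro m hm
    have hm' := (Finset.mem_filter.1 hm).2
    rw [abs_mul, abs_of_pos hg] at hm'
    have hmR : |(m : ℝ)| ≤ ⌊8 * h * a / g⌋₊ := by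
      have h1 : |(m : ℝ)| ≤ 8 * h * a / g := by rw [le_div_iff₀ hg]; linarith
      have h2 : |(m : ℝ)| = ((|m| : ℤ) : ℝ) := by push_cast; rfl
      have h3 : ((|m| : ℤ) : ℝ) ≤ 8 * h * a / g := h2 ▸ h1
      have h4 : (|m| : ℤ) ≤ ⌊8 * h * a / g⌋₊ := by
        have h5 : ((|m|).toNat : ℝ) ≤ 8 * h * a / g := by
          have : (((|m|).toNat : ℤ) : ℝ) = ((|m| : ℤ) : ℝ) := by rw [Int.toNat_of_nonneg (abs_nonneg m)]
          have h6 : ((|m|).toNat : ℝ) = (((|m|).toNat : ℤ) : ℝ) := by push_cast; rfl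
          rw [h6, this]; exact h3
        have h7 := Nat.le_floor h5
        have : (|m| : ℤ) = ((|m|).toNat : ℤ) := (Int.toNat_of_nonneg (abs_nonneg m)).symm
        rw [this]; exact_mod_cast h7
      rw [h2]; exact_mod_cast h4
    have := abs_le.1 hmR
    simp only [Finset.mem_Icc]
    exact ⟨by exact_mod_cast this.1, by exact_mod_cast this.2⟩
  have hcard : ((S.filter (fun m : ℤ => |g * m| ≤ 8 * h * a)).card : ℝ) ≤ 16 * h * a / g + 1 := by
    have h1 := Finset.card_le_card hsub
    rw [Int.card_Icc] at h1
    have h2 : ((S.filter (fun m : ℤ => |g * m| ≤ 8 * h * a)).card : ℝ) ≤ ((⌊8 * h * a / g⌋₊ + 1 - -(⌊8 * h * a / g⌋₊ : ℤ)).toNat : ℝ) := by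
      exact_mod_cast h1
    refine h2.trans ?_
    have e : ((⌊8 * h * a / g⌋₊ : ℤ) + 1 - -(⌊8 * h * a / g⌋₊ : ℤ)).toNat = 2 * ⌊8 * h * a / g⌋₊ + 1 := by omega
    rw [e]
    push_cast
    have := Nat.floor_le (show 0 ≤ 8 * h * a / g by positivity)
    have e2 : 16 * h * a / g = 2 * (8 * h * a / g) := by ring
    rw [e2]; linarith
  calc |∑ m ∈ S.filter (fun m : ℤ => |g * m| ≤ 8 * h * a), F m|
      ≤ ∑ m ∈ S.filter (fun m : ℤ => |g * m| ≤ 8 * h * a), |F m| := Finset.abs_sum_le_sum_abs _ _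
    _ ≤ ∑ m ∈ S.filter (fun m : ℤ => |g * m| ≤ 8 * h * a), bnd := Finset.sum_le_sum hpt
    _ = (S.filter (fun m : ℤ => |g * m| ≤ 8 * h * a)).card * bnd := by rw [Finset.sum_const, nsmul_eq_mul]
    _ ≤ (16 * h * a / g + 1) * bnd := mul_le_mul_of_nonneg_right hcard hbnd0

/-- **Anchor `combTypeFamilyApprox`** (registered sub-goal; `abs_sum_familyT_sub_familyW_le` with explicit quantifiers): inside the
families of one tooth the reorganised tooth terms are the family weights up to `O(h)` in total. [folklore] -/
theorem combTypeFamilyApprox : ∀ B B' : ℝ → ℝ, ∀ N₀ N₁ : ℝ, (∀ x, HasDerivAt B (B' x) x) → (∀ x, |B x| ≤ N₀) → (∀ x, |B' x| ≤ N₁) → (∀ x, 2 < |x| → B x = 0) → ∀ h : ℝ, (0 < h) → (h ≤ 1 / 16) → ∀ n ℓ ℓ' k' : ℕ, (1 ≤ n) → (1 ≤ ℓ) → (1 ≤ ℓ') → (1 ≤ k') → ∀ g : ℝ, (0 < g) → ∀ S : Finset ℤ, |∑ m ∈ S, (B ((Real.log ((n : ℝ) * ℓ' * k' / ℓ) - Real.log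 (((n : ℝ) * ℓ' * k' + g * m) / ℓ)) / h) / Real.sqrt (((n : ℝ) * ℓ' * k' + g * m) / ℓ) / Real.sqrt k' / Real.sqrt n - B (-(g * m) / ((n : ℝ) * ℓ' * h) / k') / k' * (Real.sqrt ℓ / Real.sqrt ℓ') / n)| ≤ (16 * h * ((n : ℝ) * ℓ' * k') / g + 1) * ((192 * N₁ + 12 * N₀) * h / (Real.sqrt ((n : ℝ) * ℓ' * k' / ℓ) * Real.sqrt k' * Real.sqrt n)) :=
  fun _ _ _ _ hB h0 h1 hBs _ hh hh16 _ _ _ _ hn hℓ hℓ' hk' _ hg S =>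
    abs_sum_familyT_sub_familyW_le hB h0 h1 hBs hh hh16 hn hℓ hℓ' hk' hg S

end CombType

end Summit.RiemannHypothesis.RiemannHypothesis.Theorems.SignConeConeMagnification

end
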